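import Summits.Ventures.LatticeQCDFlow.Scaling.GraphSchemeMixingCeiling
import Summits.Ventures.LatticeQCDFlow.Scaling.GraphGroundState

/-!
HONEST FRAMING: exact (Metropolis-corrected) sampling algorithms for lattice gauge theory; figures
of merit are autocorrelation/cost numbers at stated couplings and volumes; no continuum-physics
claim.

# GraphSchemeMixingLaw — EVERY CONNECTED SWAP TOPOLOGY HAS A TWO-SIDED LAW: FOR THE HOMOGENEOUS EXCHANGE SCHEME `t·ptGraphSwap ν^{⊗} e 1 + (1−t)·prodKernel w M` ON A CONNECTED
# LIST (ONE LAW, EXACT HOT SAMPLER, IDLE COLD KERNELS, `h = (1−t)w_0`) THERE ARE `ρ ∈ (0, h/(K+1)]` AND `c > 0` (THE ROBIN GROUND STATE, `Σc² = 1`) WITH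
# **`((1−ρ)/ρ)·log((1−ν(u))Σ_kc_k/(4√((2t+h)/ρ))) ≤ t_mix(1/4) ≤ ⌈(1/ρ)·log(4Σ_kc_k/c_{k₀})⌉`**, `c_{k₀} = min_kc_k` (lean-2 GEN-47, ours)

Venture-side (OURS).  Cell `lqcd-flow` (pub-lqcd), unit `pub-lqcd-lean-2-g47`, 2026-08-31.  Chapter AH (the hub–ladder interpolation), file 9 — the capstone: file 8's ground state fed to file 7.
Sizes used: `Σ_kc_k² = 1` gives `(c_{i_r} − c_{l_r})² ≤ 2` (distinct endpoints) and `c_0² ≤ 1`, so `D² = (2t + h)/ρ` serves; `c_{k₀}` is a minimising entry (`Finset.exists_min_image`).  What is NOT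
claimed: the sizes of `ρ`, `Σc`, `c_{k₀}` for a given topology (the path: chapter AG; the star: file 3); and sharpness of the FLOOR in this existence form — with the crude edge bound `Δ = 2`
its logarithm `log((1−ν(u))Σc·√(ρ/(2t+h))/4)` is informative only when `(1−ν(u))Σ_kc_k ≫ √((2t+h)/ρ)` (star-like topologies, `ρ ≍ 1/K`, `Σc ≍ K`); for slowly relaxing topologies (the
path: `Σc ≍ K`, `ρ ≍ t/K³`) the smooth ground state's own edge bound must be fed to file 7 (`graphScheme_mixingTime_two_sided_mode` takes `Δ` as input; chapter AG uses `Δ = θ²`).  The CEILING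
`⌈(1/ρ)·log(4Σc/c_{k₀})⌉` holds as stated for every connected topology.  No definitions.

* `sq_sub_le_two_of_sum_sq` (`(c_i − c_l)² ≤ 2` on the unit sphere, `i ≠ l`), `sq_le_one_of_sum_sq`, **`graphScheme_mixingTime_two_sided_exists`**.

Reading (no numerics implied): the homogeneous replica-exchange scheme on ANY connected swap graph forgets a cold start in at most `(1/ρ_G)·log(4Σc/c_{k₀})` steps, and — when the ground
state is flat enough for the floor's logarithm to be positive — in at least order `1/ρ_G` steps, where `ρ_G ≤ h/(K+1)` is the bottom eigenvalue of the Robin–Laplacian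
`(t/m)L_G + h·e_0e_0ᵀ`: the refresh budget `(K+1)/h` is universal, the transport term is the topology's.  Literature grade (cell rule): OWN; nothing
cited; no new bib keys.
-/

noncomputable section

open Finset Function Real
open Literature.Probability.MarkovChains

namespace Summit.Ventures.LatticeQCDFlow.Scaling

variable {S : Type*} [Fintype S] [DecidableEq S] {K m : ℕ} (e : Fin m → Fin (K + 1) × Fin (K + 1)) {ν : S → ℝ} {M : Fin (K + 1) → S → S → ℝ} {w : Fin (K + 1) → ℝ} {t : ℝ}
  {P : (Fin (K + 1) → S) → (Fin (K + 1) → S) → ℝ}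

omit [Fintype S] [DecidableEq S] in
/-- On the unit sphere every entry has square at most one. [ours] -/
theorem sq_le_one_of_sum_sq {c : Fin (K + 1) → ℝ} (hc : ∑ k : Fin (K + 1), c k ^ 2 = 1) (k : Fin (K + 1)) : c k ^ 2 ≤ 1 := by
  calc c k ^ 2 ≤ ∑ j : Fin (K + 1), c j ^ 2 := Finset.single_le_sum (fun j _ => sq_nonneg (c j)) (mem_univ k)
    _ = 1 := hc

omit [Fintype S] [DecidableEq S] in
/-- On the unit sphere two distinct entries differ by at most `√2`: `(c_i − c_l)² ≤ 2`. [ours] -/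
theorem sq_sub_le_two_of_sum_sq {c : Fin (K + 1) → ℝ} (hc : ∑ k : Fin (K + 1), c k ^ 2 = 1) {i l : Fin (K + 1)} (hil : i ≠ l) : (c i - c l) ^ 2 ≤ 2 := by
  have h2 : c i ^ 2 + c l ^ 2 ≤ 1 := by
    have : c i ^ 2 + c l ^ 2 = ∑ j ∈ ({i, l} : Finset (Fin (K + 1))), c j ^ 2 := by rw [Finset.sum_pair hil]
    rw [this, ← hc]
    exact Finset.sum_le_univ_sum_of_nonneg fun j => sq_nonneg (c j)
  nlinarith [sq_nonneg (c i + c l)]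

/-- **EVERY CONNECTED SWAP TOPOLOGY HAS A TWO-SIDED LAW:** `m ≥ 1`, distinct endpoints, every non-empty proper set of levels crossed by some listed pair, `0 < t < 1`, `w` a probability vector
with `w_0 > 0`, one positive law `ν`, exact hot sampler, idle cold kernels; then with `h = (1−t)w_0` there are `ρ` and a vector `c` with `0 < ρ ≤ h/(K+1)`, `c_k > 0`, `Σ_kc_k² = 1`, the
vertex equations, a minimising level `k₀`, and for every content `u`:
**`((1−ρ)/ρ)·log((1−ν(u))Σ_kc_k/(4√((2t+h)/ρ))) ≤ t_mix(1/4) ≤ ⌈(1/ρ)·log(Σ_kc_k/(c_{k₀}·¼))⌉`**. [ours] -/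
theorem graphScheme_mixingTime_two_sided_exists (hm : 1 ≤ m) (he : ∀ r, (e r).1 ≠ (e r).2)
    (hconn : ∀ A : Finset (Fin (K + 1)), A.Nonempty → A ≠ univ → ∃ r : Fin m, ((e r).1 ∈ A ∧ (e r).2 ∉ A) ∨ ((e r).2 ∈ A ∧ (e r).1 ∉ A))
    (hν : ∀ v, 0 < ν v) (hν1 : ∑ v, ν v = 1) (hM0 : ∀ u v, M 0 u v = ν v) (hidle : ∀ i : Fin K, ∀ u v, M i.succ u v = if v = u then 1 else 0)
    (hw0 : ∀ k, 0 ≤ w k) (hw00 : 0 < w 0) (hw1 : ∑ k, w k = 1) (ht0 : 0 < t) (ht1 : t < 1)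
    (hP : ∀ x y, P x y = t * ptGraphSwap (fun _ : Fin (K + 1) => ν) e (fun _ => Equiv.refl S) x y + (1 - t) * prodKernel w M x y) (u : S) :
    ∃ (ρ : ℝ) (c : Fin (K + 1) → ℝ) (k₀ : Fin (K + 1)), 0 < ρ ∧ ρ ≤ (1 - t) * w 0 / ((K : ℝ) + 1) ∧ (∀ k, 0 < c k) ∧ ∑ k : Fin (K + 1), c k ^ 2 = 1 ∧ (∀ k, c k₀ ≤ c k) ∧
      (∀ k : Fin (K + 1), t / m * ∑ r : Fin m, ((if k = (e r).1 then c (e r).2 - c (e r).1 else 0) + (if k = (e r).2 then c (e r).1 - c (e r).2 else 0))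
        - (if k = 0 then (1 - t) * w 0 * c k else 0) = -ρ * c k) ∧
      (1 - ρ) / ρ * Real.log ((1 - ν u) * (∑ k : Fin (K + 1), c k) / (4 * Real.sqrt ((2 * t + (1 - t) * w 0) / ρ)))
          ≤ (mixingTime P (tensorFun (fun _ : Fin (K + 1) => ν)) (1 / 4) : ℝ) ∧
      mixingTime P (tensorFun (fun _ : Fin (K + 1) => ν)) (1 / 4) ≤ ⌈1 / ρ * Real.log ((∑ k : Fin (K + 1), c k) / (c k₀ * (1 / 4)))⌉₊ := by
  have hh0 : 0 < (1 - t) * w 0 := mul_pos (by linarith) hw00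
  obtain ⟨c, ρ, hcpos, hcS, hρ0, hρle, hvertex⟩ := graph_groundState_exists e (t := t) (h := (1 - t) * w 0) hm ht0 hh0 hconn
  -- a minimising entry
  obtain ⟨k₀, _, hk₀⟩ := Finset.exists_min_image univ c univ_nonempty
  have hcmin : ∀ k, c k₀ ≤ c k := fun k => hk₀ k (mem_univ k)
  -- `ρ < 1`
  have hw01 : w 0 ≤ 1 := by
    calc w 0 ≤ ∑ k, w k := Finset.single_le_sum (fun k _ => hw0 k) (mem_univ 0)
      _ = 1 := hw1
  have hρ1 : ρ < 1 := by
    have hK1 : (1 : ℝ) ≤ (K : ℝ) + 1 := by have : (0:ℝ) ≤ K := Nat.cast_nonneg K; linarith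
    have : (1 - t) * w 0 / ((K : ℝ) + 1) ≤ (1 - t) * w 0 := div_le_self hh0.le hK1
    nlinarith
  -- the sizes on the unit sphere
  have hΔ : ∀ r : Fin m, (c (e r).1 - c (e r).2) ^ 2 ≤ 2 := fun r => sq_sub_le_two_of_sum_sq hcS (he r)
  set D : ℝ := Real.sqrt ((2 * t + (1 - t) * w 0) / ρ) with hD
  have hD0 : 0 < D := Real.sqrt_pos.mpr (by positivity)
  have hD2 : (t * 2 + (1 - t) * w 0 * c 0 ^ 2) / ρ ≤ D ^ 2 := by
    rw [hD, Real.sq_sqrt (by positivity)]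
    refine div_le_div_of_nonneg_right ?_ hρ0.le
    have := sq_le_one_of_sum_sq hcS 0
    nlinarith [hh0]
  have hvertex' : ∀ k : Fin (K + 1), t / m * ∑ r : Fin m, ((if k = (e r).1 then c (e r).2 - c (e r).1 else 0) + (if k = (e r).2 then c (e r).1 - c (e r).2 else 0))
      - (if k = 0 then (1 - t) * w 0 * c 0 else 0) = -ρ * c k := by
    intro k
    have := hvertex k
    by_cases hk : k = 0
    · subst hk; exact this
    · rw [if_neg hk] at this ⊢; exact this
  have htwo := graphScheme_mixingTime_two_sided_mode e hm he hν hν1 hM0 hidle hw0 hw00 hw1 ht0 ht1 hP hρ0 hρ1 (hcpos k₀) hcmin hvertex' hΔ hD0 hD2 u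
  refine ⟨ρ, c, k₀, hρ0, hρle, hcpos, hcS, hcmin, ?_, htwo.1, htwo.2⟩
  intro k
  have := hvertex k
  by_cases hk : k = 0
  · subst hk; simpa using this
  · rw [if_neg hk] at this; rw [if_neg hk]; exact this

end Summit.Ventures.LatticeQCDFlow.Scaling

end
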